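import Summits.HodgeConjecture.HodgeConjecture.Theorems.F0P3ClassificationKitV6            -- ★ V6-A (p03 (g6); RULING (V37)(1): K0 is cut against the edition of record v6): `ClassificationKit`, `Sockets`, frame vocabulary, `IsPinned` (i)–(x)
import Summits.HodgeConjecture.HodgeConjecture.Theorems.F0P3ClassTokensOfRecord             -- ★ p819048: `Cls`, `cl`, `rep`, `mult`
import Summits.HodgeConjecture.HodgeConjecture.Theorems.F0P3ClassTokenChoice                -- ★ p819116: `clFinChoice`, `evpChoice`
import Summits.HodgeConjecture.HodgeConjecture.Theorems.F0P3CompactTrivOfRecord             -- ★ p819716: `cptTriv₀`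
import Summits.HodgeConjecture.HodgeConjecture.Theorems.F0P3UnitaryLocOfRecord              -- ★ p821565 (p02 (g7), «UL»): `clInfChoiceU`, `unitaryLoc₀`, `IsCohUnitaryClass`
import Summits.HodgeConjecture.HodgeConjecture.Theorems.F0P3TestFunctionsOfRecord           -- ★ p821235: `Unr₀`, `hat₀`
import Summits.HodgeConjecture.HodgeConjecture.Theorems.F0P3SpectralSideOfRecord            -- ★ p821005: `trGp₀`
import Summits.HodgeConjecture.HodgeConjecture.Theorems.F0P3SemilocalTestFunctionsOfRecord  -- ★ p821569: `TestS₀`, `tens₀`, `chS₀`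
import Summits.HodgeConjecture.HodgeConjecture.Theorems.F0P3XiArchPacketOfRecord           -- ★ p820882 (p01 (g8), K6): `archPacketOfRecord` (+ ★ p820759 `nCompactOfRecord`, `sgnInfOfRecord`, `archTypeOfRecord`)
import HarnessLib

/-!
# Crux `H413` — T5 ED. 4, K0: **the classification kit OF RECORD `kitOfRecord`** — every pinned field a ★ term, every genuinely external datum a PARAMETER

F0∕P3 «U3-mult», cell `hodgecm-mathlib`, crux H413 (`stmt-HodgeConjecture-24833`); integrator T5 (`Cruxes/H413/Lines/F0_T5InnerFormClassification.lean` v6 b097d927;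
★ V6-A `Theorems/F0P3ClassificationKitV6.lean` (p03 (g6)): `ramCls : Cls → Set (Places L)`, pin (x)), PLAN.F0P3g5 §5 K0, RULING (V37) (F0P3-plan (g5), 2026-08-31T11:27Z:
shape ENDORSED, «cut K0 against V6-A»), skeleton cert `F0/P3/F0P3-p04/CERT-K0-skeleton.F0P3p04g7.lean` c12d241c.

`kitOfRecord 𝔰 gh ξd μω c jInf dsInf archTr ν μv ramCls₀ : ClassificationKit L H ι T hT μ` — the NAMED kit `𝔠₀` of ED. 4 at ONE frame:
* T1's nine SOCKETS (14.6.1) enter as `𝔰 : Sockets L H μ` (Theorems never import `Lines/F0_T1…`; the closer plugs `Sockets.ofT1 𝔨₀`);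
* CLASS SIDE — ★ terms of record: `Cls∕cl∕mult` (★ p819048), `evp c v := evpChoice (rep c) v (μv v)`, `clFin c v := clFinChoice (rep c) v` (★ p819116),
  `cptTriv := cptTriv₀` (★ p819716), `clInf := clInfChoiceU dflt ∘ rep` with `dflt := archDegOneClass 1` and `UnitaryLoc := unitaryLoc₀` (★ p821565, RULING (V35)∕ERRATUM 3),
  `ramCls := ramCls₀ ∘ rep` (`Set`-valued; parameter `ramCls₀` until B-p08 (g20)'s «RC» ★ `F0P3RamClsOfRecord`);
* C-PACKAGE — ★ terms of record: `TestS := TestS₀`, `Unr := Unr₀`, `tens := tens₀`, `hat := hat₀`, `trGp := trGp₀ (Gp L H) μ ν` (Haar `ν` on `G′(𝔸)` a parameter shared with T1),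
  `chS := chS₀ archTr μv` (`archTr` = D8-1 archimedean character, parameter; `μv` = Haar family at the finite places, parameter — pin (iii));
* G∕H SIDE — ONE bundled parameter `gh : GHSide … 𝔰.PacketG 𝔰.PacketH` (`TestSG∕TestSH∕tensG∕tensH∕trGS∕trHS∕MatchesS`; F0P3a∕F0P3b currency, PLAN §5 K7∕K8, RULING (V37)(3));
* ξ SIDE — ONE bundled parameter `ξd : XiSide … 𝔰.PacketG 𝔰.PacketH` ((J2) packet data `evpG evpH ramG ramH PiXi ρXi` and the ξ-family of record `ram tXi packFin`, whose
  ★ closed forms p819611∕p819729∕p820295 carry p01 (g8)'s parameter list and are plugged by the closer), plus the ★ arch data `N := nCompactOfRecord L`,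
  `sgnInf := sgnInfOfRecord ι μω`, `packInf := archPacketOfRecord ι μω jInf dsInf` (★ p820759∕p820882; `jInf dsInf` closer parameters, R-22′), `sgnG := fun _ => c` (ONE scalar, R-21),
  `cptXi := cptXi₀ ι μω` (DEFINITIONAL: the (C2♯) archimedean clause off `ι`, so law `CptXiSpec` holds by `id`).
Also: field read-backs (`rfl`).  `KitFamily`-level assembly and the pins (K1) live in the next file (they import module D).  Definitions with bodies (`GHSide`, `XiSide`,
`cptXi₀`, `kitOfRecord`); no `sorry`, no named fact, no instance, no notation; `--supports stmt-HodgeConjecture-24833 --as helper`.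
K1 NOTE (RULING (V37)(6)): ★ class-side lemmas typed over `cmDatum L 3 H` are used under `Gp L H = adelicGroupData …` (`rfl`, but `cmDatum` is not reducible for instance
search) via `haveI : (cmDatum L 3 H).IsAutomorphicMeasure μ := ‹(Gp L H).IsAutomorphicMeasure μ›`.
HONEST LABEL: HC_CM is proved only modulo the printed citations until rung 0 closes.

References: [Rogawski1990] §13.7 p. 206, §14.5–14.6 pp. 236–244, §12.3 p. 178; [Gelbart1975] (10.14); [Flath1979] Thm. 3; [CartierCorvallis1979] §IV.1.
-/

set_option autoImplicit false
-- the mandated namespace repeats `HodgeConjecture.HodgeConjecture`, as in every `Theorems/*.lean` of this sub-problem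
set_option linter.dupNamespace false

noncomputable section

open NumberField IsDedekindDomain MeasureTheory
open Literature.NumberTheory.Rogawski1990 Literature.NumberTheory.GaloisRepresentations
open Literature.NumberTheory.Automorphic Literature.NumberTheory.Automorphic.UnitaryGroup
open Literature.NumberTheory.Automorphic.UnitaryGroup.CotangentForms
open scoped Matrix

namespace Summit.HodgeConjecture.HodgeConjecture.Cruxes.H413.F0P3KitOfRecord

open Summit.HodgeConjecture.HodgeConjecture.Cruxes.H413.F0P3InnerFormClassificationV6
open Summit.HodgeConjecture.HodgeConjecture.Cruxes.H413.F0P3ClassTokensOfRecord (Cls cl rep mult)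
open Summit.HodgeConjecture.HodgeConjecture.Cruxes.H413.F0P3ClassTokenChoice (clFinChoice evpChoice)
open Summit.HodgeConjecture.HodgeConjecture.Cruxes.H413.F0P3CompactTrivOfRecord (cptTriv₀)
open Summit.HodgeConjecture.HodgeConjecture.Cruxes.H413.F0P3UnitaryLocOfRecord (clInfChoiceU unitaryLoc₀)
open Summit.HodgeConjecture.HodgeConjecture.Cruxes.H413.F0P3TestFunctionsOfRecord (Unr₀ hat₀)
open Summit.HodgeConjecture.HodgeConjecture.Cruxes.H413.F0P3SpectralSideOfRecord (trGp₀)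
open Summit.HodgeConjecture.HodgeConjecture.Cruxes.H413.F0P3SemilocalTestFunctionsOfRecord (TestS₀ tens₀ chS₀)
open Summit.HodgeConjecture.HodgeConjecture.Cruxes.H413.F0P3XiArchDataOfRecord (nCompactOfRecord sgnInfOfRecord archTypeOfRecord)
open Summit.HodgeConjecture.HodgeConjecture.Cruxes.H413.F0P3XiArchPacketOfRecord (archPacketOfRecord)
open Summit.HodgeConjecture.HodgeConjecture.Cruxes.H413.F0P3bArchDegOneClass (archDegOneClass)

variable (L : Type) [Field L] [NumberField L] [IsCMField L] (H : Matrix (Fin 3) (Fin 3) L) (ι : L →+* ℂ) (T : GL (Fin 3) ℂ)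
  (hT : (T : Matrix (Fin 3) (Fin 3) ℂ)ᴴ * H.map ι * (T : Matrix (Fin 3) (Fin 3) ℂ) = Literature.Geometry.ComplexHyperbolic.BallModel.J)

/-! ## §1 The two bundled parameters: G∕H-side `S`-carriers and ξ-side packet data -/

/-- **`GHSide L H ι T hT PG PH`** — the `S`-level carriers on the quasi-split side `G = U(Φ₃)` and the endoscopic side `H = U(Φ₂) × U(Φ₁)`, bundled (RULING (V37)(3)):
test data `TestSG S`∕`TestSH S`, the tensors `f = f_S ⊗ b(f^S)`, `f^H = f^H_S ⊗ b_H(f^S)` into T1's `TestG`∕`TestH`, the `S`-level packet traces `Tr Π_S(f_S)`, `Tr ρ_S(f^H_S)` on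
T1's packet types `PG = 𝔰.PacketG`, `PH = 𝔰.PacketH`, and the `S`-level matching relation.  F0P3a∕F0P3b currency (the fundamental-lemma map `b`, `ξ_H`, local Δ-transfer);
typed there (PLAN.F0P3g5 §5 K7∕K8) — a PARAMETER of `kitOfRecord`. [Rogawski1990 §4.9, §13.2, (14.2.1) p. 232, §14.3] -/
structure GHSide (PG PH : Type) : Type 1 where
  /-- `S ∪ ∞`-level test data on `G` -/
  TestSG : Finset (Places L) → Type
  /-- `S ∪ ∞`-level test data on `H` -/
  TestSH : Finset (Places L) → Type
  /-- `f = f_S ⊗ b(f^S) ∈ C_c(G(𝔸))` -/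
  tensG : ∀ S, TestSG S → Unr₀ L H S → TestG L
  /-- `f^H = f^H_S ⊗ b_H(f^S) ∈ C_c(H(𝔸))` -/
  tensH : ∀ S, TestSH S → Unr₀ L H S → TestH L
  /-- `Tr Π_S(f_S)` -/
  trGS : ∀ S, PG → TestSG S → ℂ
  /-- `Tr ρ_S(f^H_S)` -/
  trHS : ∀ S, PH → TestSH S → ℂ
  /-- `S`-level matching of `(f′_{S,∞}, f_S, f^H_S)` -/
  MatchesS : ∀ S, TestS₀ L H ι T hT S → TestSG S → TestSH S → Prop

/-- **`XiSide L H PG PH`** — the ξ-indexed and packet-indexed data of (14.6.2)∕(14.6.3), bundled: the e.v.p.'s and ramification of T1's global packets (`evpG evpH ramG ramH`),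
the packets `Π(ξ)`, `ρ(ξ) = ξ` (`PiXi ρXi`) — (J2) export data — and the ξ-LOCAL FAMILY OF RECORD at the finite places (`ram tXi packFin`; ★ closed forms
`ramOfRecord₂`, `xiEvpOfRecord`, `xiPacketFamilyOfRecord` of p01 (g7∕g8), plugged by the closer with their own parameter lists).  A PARAMETER of `kitOfRecord`.
[Rogawski1990 §13.1, §13.3, §12.2; (14.6.3)] -/
structure XiSide (PG PH : Type) : Type 1 where
  /-- e.v.p. of a global packet of `G` -/
  evpG : PG → EvpData L H
  /-- e.v.p. of a global packet of `H` (through `ξ_H`) -/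
  evpH : PH → EvpData L H
  /-- ramification of a global packet of `G` -/
  ramG : PG → Finset (Places L)
  /-- ramification of a global packet of `H` -/
  ramH : PH → Finset (Places L)
  /-- `ξ ↦ Π(ξ)` -/
  PiXi : OneDimAutRepH L → PG
  /-- `ξ ↦ ρ(ξ) = ξ` as a packet of `H` -/
  ρXi : OneDimAutRepH L → PH
  /-- `ram ξ` (the finite exceptional set of the ξ-family of record) -/
  ram : OneDimAutRepH L → Finset (Places L)
  /-- `t(ξ)` (the e.v.p. of `Π(ξ)`, eigencharacter currency) -/
  tXi : OneDimAutRepH L → EvpData L H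
  /-- the finite local A-packets `Π(ξ_v)` of record -/
  packFin : OneDimAutRepH L → ∀ v : Places L, CMLocalAPacket L H v

/-! ## §2 `cptXi₀` — the compact factor of (14.6.3), read back (DEFINITIONAL at 𝔠₀) -/

variable {L H}

/-- **`cptXi₀ ι μω ξ`** («`F_{ξ,τ} = 𝟙` at every compact `τ`», RULING (V31)(v); PLAN.F0P3g4 add. 2 §2): at every complex embedding `ι′` NOT over `ι` the component
`ξ_{ι′}` is of cohomological type for trivial coefficients w.r.t. Rogawski's parameter of `μω` at every unitary archimedean type `k` (★ `OneDimAutRepH.IsCohTrivialAt`,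
★ `ArchSignRecipe.tOfArchType`, ★ `HeckeCharacter.HasUnitaryArchType`) — the text of law `CptXiSpec μω`'s conclusion, so that law holds at 𝔠₀ by `id`.
[cite: Rogawski1990, §12.3 p. 176; §14.6 p. 244] -/
def cptXi₀ (ι : L →+* ℂ) (μω : HeckeCharacter L) (ξ : OneDimAutRepH L) : Prop :=
  ∀ k : InfinitePlace L → ℤ, μω.HasUnitaryArchType k (fun _ => 0) →
    ∀ ι' : L →+* ℂ, InfinitePlace.mk ι' ≠ InfinitePlace.mk ι → ξ.IsCohTrivialAt (ArchSignRecipe.tOfArchType k ι') ι'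

/-- Unfolding `cptXi₀`. [cite: Rogawski1990, §12.3 p. 176] -/
theorem cptXi₀_iff (ι : L →+* ℂ) (μω : HeckeCharacter L) (ξ : OneDimAutRepH L) :
    cptXi₀ ι μω ξ ↔ ∀ k : InfinitePlace L → ℤ, μω.HasUnitaryArchType k (fun _ => 0) →
      ∀ ι' : L →+* ℂ, InfinitePlace.mk ι' ≠ InfinitePlace.mk ι → ξ.IsCohTrivialAt (ArchSignRecipe.tOfArchType k ι') ι' :=
  Iff.rfl

/-! ## §3 THE KIT OF RECORD `𝔠₀ = kitOfRecord …` at one frame -/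

variable (L H)
variable (μ : Measure (Gp L H).automorphicQuotient) [(Gp L H).IsAutomorphicMeasure μ]
  [MeasurableSpace (Gp L H).Adelic] [BorelSpace (Gp L H).Adelic]

/-- **`kitOfRecord` — THE CLASSIFICATION KIT OF RECORD `𝔠₀`** (PLAN.F0P3g5 §5 K0, RULING (V37)): T1's sockets `𝔰`; the CLASS SIDE and the C-PACKAGE by the ★ tokens of
record; the G∕H side `gh`, the ξ∕packet data `ξd`, Rogawski's auxiliary character `μω`, the ONE global sign `c` (R-21), the posited archimedean classes `jInf dsInf` (R-22′),
the archimedean character `archTr` (D8-1), the Haar measure `ν` on `G′(𝔸)` (T1's) and the Haar family `μv` at the finite places, and (until «RC» is ★) the exact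
ramification set `ramCls₀` as PARAMETERS.  [cite: Rogawski1990, §14.5 p. 237; §14.6 Thm. 14.6.4 pp. 236–244; §13.7 p. 206] -/
def kitOfRecord (𝔰 : Sockets L H μ) (gh : GHSide L H ι T hT 𝔰.PacketG 𝔰.PacketH) (ξd : XiSide L H 𝔰.PacketG 𝔰.PacketH)
    (μω : HeckeCharacter L) (c : ℚ) (jInf dsInf : ℤ → ℤ → ℤ → Cinf)
    (archTr : Cinf → (UnitaryGroup.arch (↥(maximalRealSubfield L)) L (IsCMField.complexConj L) 3 H → ℂ) → ℂ)
    (ν : Measure (Gp L H).Adelic) [IsFiniteMeasureOnCompacts ν]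
    (μv : ∀ v : Places L, @Measure ((cmDatum L 3 H).Local v) (borel _))
    (ramCls₀ : DiscreteAutomorphicRep (Gp L H) μ → Set (Places L)) :   -- = ★-to-be `F0P3RamClsOfRecord.ramCls₀` (B-p08 (g20)); a parameter until «RC» is ★
    ClassificationKit L H ι T hT μ :=
  { 𝔰 with
    Cls := Cls (Gp L H) μ
    cl := cl (Gp L H) μ
    mult := mult (Gp L H) μ
    ramCls := fun x => ramCls₀ (rep (Gp L H) μ x)
    evp := fun x v => evpChoice (rep (Gp L H) μ x) v (μv v)
    cptTriv := cptTriv₀ L ι H T hT μ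
    clFin := fun x v => clFinChoice (rep (Gp L H) μ x) v
    clInf := fun x => clInfChoiceU L H ι T hT μ (archDegOneClass 1 (Or.inl rfl)) (rep (Gp L H) μ x)
    UnitaryLoc := unitaryLoc₀ L H
    μv := μv
    TestS := TestS₀ L H ι T hT
    Unr := Unr₀ L H
    tens := fun S fS fT => tens₀ S fS fT
    hat := hat₀ L H
    trGp := trGp₀ (Gp L H) μ ν
    chS := chS₀ archTr μv
    evpG := ξd.evpG
    evpH := ξd.evpH
    ramG := ξd.ramG
    ramH := ξd.ramH
    TestSG := gh.TestSG
    TestSH := gh.TestSH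
    tensG := gh.tensG
    tensH := gh.tensH
    trGS := gh.trGS
    trHS := gh.trHS
    MatchesS := gh.MatchesS
    ram := ξd.ram
    tXi := ξd.tXi
    PiXi := ξd.PiXi
    ρXi := ξd.ρXi
    sgnG := fun _ => c
    N := fun _ => nCompactOfRecord L
    packInf := archPacketOfRecord ι μω jInf dsInf
    cptXi := cptXi₀ ι μω
    packFin := ξd.packFin
    sgnInf := sgnInfOfRecord ι μω }

/-! ## §4 Read-backs (`rfl`) — the fields of `𝔠₀` BY NAME, for K1 (pins) and K2 (laws) -/

section ReadBacks

variable (𝔰 : Sockets L H μ) (gh : GHSide L H ι T hT 𝔰.PacketG 𝔰.PacketH) (ξd : XiSide L H 𝔰.PacketG 𝔰.PacketH)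
  (μω : HeckeCharacter L) (c : ℚ) (jInf dsInf : ℤ → ℤ → ℤ → Cinf)
  (archTr : Cinf → (UnitaryGroup.arch (↥(maximalRealSubfield L)) L (IsCMField.complexConj L) 3 H → ℂ) → ℂ)
  (ν : Measure (Gp L H).Adelic) [IsFiniteMeasureOnCompacts ν]
  (μv : ∀ v : Places L, @Measure ((cmDatum L 3 H).Local v) (borel _))
  (ramCls₀ : DiscreteAutomorphicRep (Gp L H) μ → Set (Places L))

/-- `𝔠₀.Cls = Cls (Gp L H) μ`. -/
theorem kitOfRecord_Cls : (kitOfRecord L H ι T hT μ 𝔰 gh ξd μω c jInf dsInf archTr ν μv ramCls₀).Cls = Cls (Gp L H) μ := rfl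
/-- `𝔠₀.cl = cl`. -/
theorem kitOfRecord_cl (P : DiscreteAutomorphicRep (Gp L H) μ) : (kitOfRecord L H ι T hT μ 𝔰 gh ξd μω c jInf dsInf archTr ν μv ramCls₀).cl P = cl (Gp L H) μ P := rfl
/-- `𝔠₀.mult = mult`. -/
theorem kitOfRecord_mult (x : Cls (Gp L H) μ) : (kitOfRecord L H ι T hT μ 𝔰 gh ξd μω c jInf dsInf archTr ν μv ramCls₀).mult x = mult (Gp L H) μ x := rfl
/-- `𝔠₀.ramCls x = ramCls₀ (rep x)`. -/
theorem kitOfRecord_ramCls (x : Cls (Gp L H) μ) :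
    (kitOfRecord L H ι T hT μ 𝔰 gh ξd μω c jInf dsInf archTr ν μv ramCls₀).ramCls x = ramCls₀ (rep (Gp L H) μ x) := rfl
/-- `𝔠₀.evp x v = evpChoice (rep x) v (μv v)`. -/
theorem kitOfRecord_evp (x : Cls (Gp L H) μ) (v : Places L) :
    (kitOfRecord L H ι T hT μ 𝔰 gh ξd μω c jInf dsInf archTr ν μv ramCls₀).evp x v = evpChoice (rep (Gp L H) μ x) v (μv v) := rfl
/-- `𝔠₀.cptTriv = cptTriv₀`. -/
theorem kitOfRecord_cptTriv (x : Cls (Gp L H) μ) :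
    (kitOfRecord L H ι T hT μ 𝔰 gh ξd μω c jInf dsInf archTr ν μv ramCls₀).cptTriv x = cptTriv₀ L ι H T hT μ x := rfl
/-- `𝔠₀.clFin x v = clFinChoice (rep x) v`. -/
theorem kitOfRecord_clFin (x : Cls (Gp L H) μ) (v : Places L) :
    (kitOfRecord L H ι T hT μ 𝔰 gh ξd μω c jInf dsInf archTr ν μv ramCls₀).clFin x v = clFinChoice (rep (Gp L H) μ x) v := rfl
/-- `𝔠₀.clInf x = clInfChoiceU [J⁺] (rep x)`. -/
theorem kitOfRecord_clInf (x : Cls (Gp L H) μ) :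
    (kitOfRecord L H ι T hT μ 𝔰 gh ξd μω c jInf dsInf archTr ν μv ramCls₀).clInf x =
      clInfChoiceU L H ι T hT μ (archDegOneClass 1 (Or.inl rfl)) (rep (Gp L H) μ x) := rfl
/-- `𝔠₀.UnitaryLoc = unitaryLoc₀`. -/
theorem kitOfRecord_UnitaryLoc (S : Finset (Places L)) (x : LocS L H S) :
    (kitOfRecord L H ι T hT μ 𝔰 gh ξd μω c jInf dsInf archTr ν μv ramCls₀).UnitaryLoc S x = unitaryLoc₀ L H S x := rfl
/-- `𝔠₀.coordS S x = (clInfChoiceU [J⁺] (rep x), fun v => clFinChoice (rep x) v)` — the shape ★ `unitaryCoord₀_archDegOne` reads. -/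
theorem kitOfRecord_coordS (S : Finset (Places L)) (x : Cls (Gp L H) μ) :
    (kitOfRecord L H ι T hT μ 𝔰 gh ξd μω c jInf dsInf archTr ν μv ramCls₀).coordS S x =
      (clInfChoiceU L H ι T hT μ (archDegOneClass 1 (Or.inl rfl)) (rep (Gp L H) μ x), fun v : ↥S => clFinChoice (rep (Gp L H) μ x) v.1) := rfl
/-- `𝔠₀.hat = hat₀`. -/
theorem kitOfRecord_hat (S : Finset (Places L)) (g : Germ L H S) (F : Unr₀ L H S) :
    (kitOfRecord L H ι T hT μ 𝔰 gh ξd μω c jInf dsInf archTr ν μv ramCls₀).hat S g F = hat₀ L H S g F := rfl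
/-- `𝔠₀.tens = tens₀`. -/
theorem kitOfRecord_tens (S : Finset (Places L)) (fS : TestS₀ L H ι T hT S) (fT : Unr₀ L H S) :
    (kitOfRecord L H ι T hT μ 𝔰 gh ξd μω c jInf dsInf archTr ν μv ramCls₀).tens S fS fT = tens₀ S fS fT := rfl
/-- `𝔠₀.trGp = trGp₀`. -/
theorem kitOfRecord_trGp (x : Cls (Gp L H) μ) (F : TestGp L H) :
    (kitOfRecord L H ι T hT μ 𝔰 gh ξd μω c jInf dsInf archTr ν μv ramCls₀).trGp x F = trGp₀ (Gp L H) μ ν x F := rfl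
/-- `𝔠₀.chS = chS₀ archTr μv`. -/
theorem kitOfRecord_chS (S : Finset (Places L)) (x : LocS L H S) (fS : TestS₀ L H ι T hT S) :
    (kitOfRecord L H ι T hT μ 𝔰 gh ξd μω c jInf dsInf archTr ν μv ramCls₀).chS S x fS = chS₀ archTr μv S x fS := rfl
/-- `𝔠₀.sgnG ξ = c`. -/
theorem kitOfRecord_sgnG (ξ : OneDimAutRepH L) : (kitOfRecord L H ι T hT μ 𝔰 gh ξd μω c jInf dsInf archTr ν μv ramCls₀).sgnG ξ = c := rfl
/-- `𝔠₀.N ξ = nCompactOfRecord L`. -/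
theorem kitOfRecord_N (ξ : OneDimAutRepH L) : (kitOfRecord L H ι T hT μ 𝔰 gh ξd μω c jInf dsInf archTr ν μv ramCls₀).N ξ = nCompactOfRecord L := rfl
/-- `𝔠₀.packInf = archPacketOfRecord ι μω jInf dsInf`. -/
theorem kitOfRecord_packInf (ξ : OneDimAutRepH L) :
    (kitOfRecord L H ι T hT μ 𝔰 gh ξd μω c jInf dsInf archTr ν μv ramCls₀).packInf ξ = archPacketOfRecord ι μω jInf dsInf ξ := rfl
/-- `𝔠₀.cptXi = cptXi₀ ι μω`. -/
theorem kitOfRecord_cptXi (ξ : OneDimAutRepH L) : (kitOfRecord L H ι T hT μ 𝔰 gh ξd μω c jInf dsInf archTr ν μv ramCls₀).cptXi ξ = cptXi₀ ι μω ξ := rfl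
/-- `𝔠₀.sgnInf = sgnInfOfRecord ι μω`. -/
theorem kitOfRecord_sgnInf (ξ : OneDimAutRepH L) : (kitOfRecord L H ι T hT μ 𝔰 gh ξd μω c jInf dsInf archTr ν μv ramCls₀).sgnInf ξ = sgnInfOfRecord ι μω ξ := rfl
/-- `𝔠₀.traceGp = 𝔰.traceGp` (T1's socket, untouched). -/
theorem kitOfRecord_traceGp : (kitOfRecord L H ι T hT μ 𝔰 gh ξd μω c jInf dsInf archTr ν μv ramCls₀).traceGp = 𝔰.traceGp := rfl

end ReadBacks

end Summit.HodgeConjecture.HodgeConjecture.Cruxes.H413.F0P3KitOfRecord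

end
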